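import Summits.QuantumFields.YangMills.Theorems.FlatTubeReductionProfileLevelSetVolume
import HarnessLib

/-!
# The volume-growth hypothesis `hV` of the weighted layer cake for the reference weight, in closed form: `∫_{β·kinDefect ≤ t} Ω·fpWeight·Ω dμP ≤ V·(t+1)^{3(|Λ|−1)}` with
# `V = fpZ ε·(π²/12)^n(3L)^{3n}3^{3n}·β^{-3n/2}·[I₀² + ((5√2)^{3n} + (√2)^{3n})·I₀·M_{3n}]`, `I₀ = ∫Ω dπ`, `M_{3n} = ∫Ω(√β‖v̂‖)^{3n} dπ` (PROFILE MOMENTS ONLY)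
# (route `FlatTubeReduction`, crux K1 `NearFlatRatioLaw` stmt-QuantumFields-24720; seat `ym-line-ftr-p1` g12; rate twin «ratepack-v3 / frozen fibres»; R2b1 RECORD rung — no summit
# statement is proved here)

WHY (memo `Cruxes/NearFlatRatioLaw/Lines/ratepack-v3-frozen-g12.md` §5.9 (b)).  Expands `…ProfileLevelSetVolume.setIntegral_profile_kinLevelSet_le` at `D = t/β` by
`(a + b + c)^k ≤ 3^k(a^k + b^k + c^k)` and `√t ≤ t + 1`, pulling the β-scaling `β^{-3n/2}` out of every term; what remains of the profile are its mass `I₀` and its Gaussian moment `M_{3n}`.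
* `pow_add_three_le`;  ★★ `profile_volume_growth`.
HONEST FRAMING: real-analysis bookkeeping; femto rung R2b1 (RECORD label); not infinite volume, not a gap, not Clay.  No defs, no named facts, no `sorry`.
-/

set_option autoImplicit false

noncomputable section

open MeasureTheory Filter Topology Real Set
open scoped BigOperators ENNReal
open Literature.MathematicalPhysics.QuantumFieldTheory
open Literature.MathematicalPhysics.QuantumLattice

namespace Summit.QuantumFields.YangMills.Theorems.FemtoTransferGap.RateTube

open Summit.QuantumFields.YangMills.Theorems.FemtoTransferGap
open Summit.QuantumFields.YangMills.Theorems.FemtoTransferGap.TwoLattice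
open Summit.QuantumFields.YangMills.Theorems.FemtoTransferGap.TwoLattice.ConstTube
open Summit.QuantumFields.YangMills.Theorems.FemtoTransferGap.TwoLattice.Avg
open Summit.QuantumFields.YangMills.Theorems.FemtoTransferGap.TwoLattice.Stiff (LinkSpace)

variable {L : ℕ} [NeZero L]

/-! ## §1 Elementary inequalities -/

omit [NeZero L] in
/-- `(a + b + c)^k ≤ 3^k·(a^k + b^k + c^k)` for `a, b, c ≥ 0`. [folklore] -/
theorem pow_add_three_le {a b c : ℝ} (ha : 0 ≤ a) (hb : 0 ≤ b) (hc : 0 ≤ c) (k : ℕ) : (a + b + c) ^ k ≤ 3 ^ k * (a ^ k + b ^ k + c ^ k) := by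
  have hm : a + b + c ≤ 3 * max a (max b c) := by
    have h1 := le_max_left a (max b c); have h2 := (le_max_left b c).trans (le_max_right a (max b c)); have h3 := (le_max_right b c).trans (le_max_right a (max b c))
    linarith
  have hM : max a (max b c) ^ k ≤ a ^ k + b ^ k + c ^ k := by
    rcases le_total a (max b c) with h | h
    · rw [max_eq_right h]
      rcases le_total b c with h' | h'
      · rw [max_eq_right h']; nlinarith [pow_nonneg ha k, pow_nonneg hb k]
      · rw [max_eq_left h']; nlinarith [pow_nonneg ha k, pow_nonneg hc k]
    · rw [max_eq_left h]; nlinarith [pow_nonneg hb k, pow_nonneg hc k]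
  calc (a + b + c) ^ k ≤ (3 * max a (max b c)) ^ k := pow_le_pow_left₀ (by positivity) hm k
    _ = 3 ^ k * max a (max b c) ^ k := by rw [mul_pow]
    _ ≤ 3 ^ k * (a ^ k + b ^ k + c ^ k) := mul_le_mul_of_nonneg_left hM (by positivity)

/-! ## §2 ★★ The volume growth in closed form -/

set_option maxHeartbeats 400000 in
/-- ★★ **Volume growth of the reference weight, closed form.**  `β > 0`, `Ω ≥ 0` bounded measurable with support in the capped balanced set and `‖v̂‖ ≤ R` there, `ε` any; with
`n = |Λ| − 1`, `I₀ = ∫Ω(v̂)dπ`, `M = ∫Ω(v̂)(√β‖v̂‖)^{3n}dπ`:  for every `t ≥ 0`,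
`∫_{β·kinDefect(oT 1 v,oT 1 v′,g) ≤ t} Ω(v̂)·fpWeight ε(g)·Ω(v̂′) dμP ≤ [fpZ ε·(π²/12)^n(3L)^{3n}3^{3n}((√β)⁻¹)^{3n}·(I₀² + ((5√2)^{3n} + (√2)^{3n})·I₀·M)]·(t+1)^{3n}`. [cite: Luscher1983, §3] -/
theorem profile_volume_growth {β : ℝ} (hβ : 0 < β) {Ω : LinkSpace L → ℝ} (hΩm : Measurable Ω) {CΩ : ℝ} (hCΩ : ∀ x, |Ω x| ≤ CΩ) (hΩ0 : ∀ x, 0 ≤ Ω x) {R : ℝ}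
    (hΩt : ∀ v : Edge 3 L → Fin 3 → ℝ, Ω (linkEmbed L v) ≠ 0 → v ∈ capBalancedSet L ∧ ‖linkEmbed L v‖ ≤ R) (ε : ℝ) {t : ℝ} (ht : 0 ≤ t) :
    ∫ p in {p : (Edge 3 L → Fin 3 → ℝ) × ((Edge 3 L → Fin 3 → ℝ) × (Site 3 L → SU2)) | β * kinDefect L (orthoTube L 1 p.1) (orthoTube L 1 p.2.1) p.2.2 ≤ t},
        Ω (linkEmbed L p.1) * (fpWeight L ε p.2.2 * Ω (linkEmbed L p.2.1)) ∂((orthoTransverse L).prod ((orthoTransverse L).prod (gaugeMeasure L))) ≤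
      (fpZ ε * ((π ^ 2 / 12) ^ Fintype.card {x : Site 3 L // ¬x = 0} * (3 * (L : ℝ)) ^ (3 * Fintype.card {x : Site 3 L // ¬x = 0}) *
          3 ^ (3 * Fintype.card {x : Site 3 L // ¬x = 0}) * ((Real.sqrt β)⁻¹) ^ (3 * Fintype.card {x : Site 3 L // ¬x = 0})) *
        ((∫ v, Ω (linkEmbed L v) ∂orthoTransverse L) ^ 2 +
          ((5 * Real.sqrt 2) ^ (3 * Fintype.card {x : Site 3 L // ¬x = 0}) + Real.sqrt 2 ^ (3 * Fintype.card {x : Site 3 L // ¬x = 0})) *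
            (∫ v, Ω (linkEmbed L v) ∂orthoTransverse L) * ∫ v, Ω (linkEmbed L v) * (Real.sqrt β * ‖linkEmbed L v‖) ^ (3 * Fintype.card {x : Site 3 L // ¬x = 0}) ∂orthoTransverse L)) *
        (t + 1) ^ (3 * Fintype.card {x : Site 3 L // ¬x = 0}) := by
  haveI := isFiniteMeasure_orthoTransverse L
  set n : ℕ := Fintype.card {x : Site 3 L // ¬x = 0} with hn
  set π' := orthoTransverse L with hπ
  have hCΩ0 : 0 ≤ CΩ := (abs_nonneg _).trans (hCΩ 0)
  have hle : Measurable (linkEmbed L) := measurable_linkEmbed L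
  -- abbreviations
  set sβ : ℝ := (Real.sqrt β)⁻¹ with hsβ
  have hsβ0 : 0 < sβ := by rw [hsβ]; exact inv_pos.mpr (Real.sqrt_pos.mpr hβ)
  set I₀ : ℝ := ∫ v, Ω (linkEmbed L v) ∂π' with hI₀
  set Mm : ℝ := ∫ v, Ω (linkEmbed L v) * (Real.sqrt β * ‖linkEmbed L v‖) ^ (3 * n) ∂π' with hMm
  have hI₀0 : 0 ≤ I₀ := integral_nonneg fun v => hΩ0 _
  have hMm0 : 0 ≤ Mm := integral_nonneg fun v => mul_nonneg (hΩ0 _) (by positivity)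
  -- the level set at `D = t/β`
  have hset : {p : (Edge 3 L → Fin 3 → ℝ) × ((Edge 3 L → Fin 3 → ℝ) × (Site 3 L → SU2)) | β * kinDefect L (orthoTube L 1 p.1) (orthoTube L 1 p.2.1) p.2.2 ≤ t} =
      {p | kinDefect L (orthoTube L 1 p.1) (orthoTube L 1 p.2.1) p.2.2 ≤ t / β} := by
    ext p; simp only [Set.mem_setOf_eq]; rw [le_div_iff₀ hβ, mul_comm]
  rw [hset]
  have hmain := setIntegral_profile_kinLevelSet_le (L := L) hΩm hCΩ hΩ0 hΩt ε (t / β)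
  refine hmain.trans ?_
  -- pointwise expansion of the box
  have hD : Real.sqrt (t / β) = Real.sqrt t * sβ := by rw [hsβ, Real.sqrt_div ht, div_eq_mul_inv]
  have hbox : ∀ v v' : Edge 3 L → Fin 3 → ℝ,
      (π ^ 2 / 12 * (3 * L * (Real.sqrt (t / β) + 5 * (Real.sqrt 2 * ‖linkEmbed L v‖) + Real.sqrt 2 * ‖linkEmbed L v'‖)) ^ 3) ^ n ≤
        (π ^ 2 / 12) ^ n * (3 * (L : ℝ)) ^ (3 * n) * 3 ^ (3 * n) * sβ ^ (3 * n) *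
          ((t + 1) ^ (3 * n) + (5 * Real.sqrt 2) ^ (3 * n) * (Real.sqrt β * ‖linkEmbed L v‖) ^ (3 * n) + Real.sqrt 2 ^ (3 * n) * (Real.sqrt β * ‖linkEmbed L v'‖) ^ (3 * n)) := by
    intro v v'
    have hL0 : (0 : ℝ) ≤ L := Nat.cast_nonneg _
    have e1 : (π ^ 2 / 12 * (3 * L * (Real.sqrt (t / β) + 5 * (Real.sqrt 2 * ‖linkEmbed L v‖) + Real.sqrt 2 * ‖linkEmbed L v'‖)) ^ 3) ^ n =
        (π ^ 2 / 12) ^ n * (3 * (L : ℝ)) ^ (3 * n) * (Real.sqrt (t / β) + 5 * (Real.sqrt 2 * ‖linkEmbed L v‖) + Real.sqrt 2 * ‖linkEmbed L v'‖) ^ (3 * n) := by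
      rw [mul_pow, mul_pow, mul_pow, ← pow_mul, ← pow_mul, mul_assoc]
    rw [e1]
    have h3 := pow_add_three_le (Real.sqrt_nonneg (t / β)) (by positivity : 0 ≤ 5 * (Real.sqrt 2 * ‖linkEmbed L v‖)) (by positivity : 0 ≤ Real.sqrt 2 * ‖linkEmbed L v'‖) (3 * n)
    -- each of the three powers carries the factor `sβ^{3n}`
    have ea : Real.sqrt (t / β) ^ (3 * n) = sβ ^ (3 * n) * Real.sqrt t ^ (3 * n) := by rw [hD, mul_pow, mul_comm]
    have hββ : Real.sqrt β * sβ = 1 := by rw [hsβ, mul_inv_cancel₀ (Real.sqrt_pos.mpr hβ).ne']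
    have eb : (5 * (Real.sqrt 2 * ‖linkEmbed L v‖)) ^ (3 * n) = sβ ^ (3 * n) * ((5 * Real.sqrt 2) ^ (3 * n) * (Real.sqrt β * ‖linkEmbed L v‖) ^ (3 * n)) := by
      have e : 5 * (Real.sqrt 2 * ‖linkEmbed L v‖) = sβ * ((5 * Real.sqrt 2) * (Real.sqrt β * ‖linkEmbed L v‖)) := by
        calc 5 * (Real.sqrt 2 * ‖linkEmbed L v‖) = (Real.sqrt β * sβ) * (5 * (Real.sqrt 2 * ‖linkEmbed L v‖)) := by rw [hββ, one_mul]
          _ = sβ * ((5 * Real.sqrt 2) * (Real.sqrt β * ‖linkEmbed L v‖)) := by ring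
      rw [e, mul_pow, mul_pow]
    have ec : (Real.sqrt 2 * ‖linkEmbed L v'‖) ^ (3 * n) = sβ ^ (3 * n) * (Real.sqrt 2 ^ (3 * n) * (Real.sqrt β * ‖linkEmbed L v'‖) ^ (3 * n)) := by
      have e : Real.sqrt 2 * ‖linkEmbed L v'‖ = sβ * (Real.sqrt 2 * (Real.sqrt β * ‖linkEmbed L v'‖)) := by
        calc Real.sqrt 2 * ‖linkEmbed L v'‖ = (Real.sqrt β * sβ) * (Real.sqrt 2 * ‖linkEmbed L v'‖) := by rw [hββ, one_mul]
          _ = sβ * (Real.sqrt 2 * (Real.sqrt β * ‖linkEmbed L v'‖)) := by ring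
      rw [e, mul_pow, mul_pow]
    have hsq1 : Real.sqrt t ≤ t + 1 := by rw [Real.sqrt_le_left (by linarith)]; nlinarith
    have hst : Real.sqrt t ^ (3 * n) ≤ (t + 1) ^ (3 * n) := pow_le_pow_left₀ (Real.sqrt_nonneg _) hsq1 _
    rw [ea, eb, ec] at h3
    have hs0 : 0 ≤ sβ ^ (3 * n) := pow_nonneg hsβ0.le _
    have h4 : sβ ^ (3 * n) * Real.sqrt t ^ (3 * n) ≤ sβ ^ (3 * n) * (t + 1) ^ (3 * n) := mul_le_mul_of_nonneg_left hst hs0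
    have hK0 : 0 ≤ (π ^ 2 / 12) ^ n * (3 * (L : ℝ)) ^ (3 * n) := by positivity
    calc (π ^ 2 / 12) ^ n * (3 * (L : ℝ)) ^ (3 * n) * (Real.sqrt (t / β) + 5 * (Real.sqrt 2 * ‖linkEmbed L v‖) + Real.sqrt 2 * ‖linkEmbed L v'‖) ^ (3 * n)
        ≤ (π ^ 2 / 12) ^ n * (3 * (L : ℝ)) ^ (3 * n) * (3 ^ (3 * n) * (sβ ^ (3 * n) * (t + 1) ^ (3 * n) +
            sβ ^ (3 * n) * ((5 * Real.sqrt 2) ^ (3 * n) * (Real.sqrt β * ‖linkEmbed L v‖) ^ (3 * n)) + sβ ^ (3 * n) * (Real.sqrt 2 ^ (3 * n) * (Real.sqrt β * ‖linkEmbed L v'‖) ^ (3 * n)))) :=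
          mul_le_mul_of_nonneg_left (h3.trans (mul_le_mul_of_nonneg_left (by linarith [h4]) (by positivity))) hK0
      _ = _ := by ring
  -- integrability of the profile moments
  have hΩvb : ∀ v : Edge 3 L → Fin 3 → ℝ, |Ω (linkEmbed L v)| ≤ CΩ := fun v => hCΩ _
  have hΩvi : Integrable (fun v : Edge 3 L → Fin 3 → ℝ => Ω (linkEmbed L v)) π' := integrable_of_measurable_abs_le _ (hΩm.comp hle) hΩvb
  have hmom_b : ∀ v : Edge 3 L → Fin 3 → ℝ, |Ω (linkEmbed L v) * (Real.sqrt β * ‖linkEmbed L v‖) ^ (3 * n)| ≤ CΩ * (Real.sqrt β * |R|) ^ (3 * n) := fun v => by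
    by_cases hz : Ω (linkEmbed L v) = 0
    · rw [hz, zero_mul, abs_zero]; positivity
    · rw [abs_mul, abs_of_nonneg (by positivity : 0 ≤ (Real.sqrt β * ‖linkEmbed L v‖) ^ (3 * n))]
      exact mul_le_mul (hCΩ _) (pow_le_pow_left₀ (by positivity) (mul_le_mul_of_nonneg_left (((hΩt v hz).2).trans (le_abs_self R)) (Real.sqrt_nonneg _)) _)
        (by positivity) hCΩ0
  have hmom_m : Measurable fun v : Edge 3 L → Fin 3 → ℝ => Ω (linkEmbed L v) * (Real.sqrt β * ‖linkEmbed L v‖) ^ (3 * n) := (hΩm.comp hle).mul ((hle.norm.const_mul _).pow_const _)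
  have hmom_i : Integrable (fun v : Edge 3 L → Fin 3 → ℝ => Ω (linkEmbed L v) * (Real.sqrt β * ‖linkEmbed L v‖) ^ (3 * n)) π' := integrable_of_measurable_abs_le _ hmom_m hmom_b
  -- the constant
  set K : ℝ := (π ^ 2 / 12) ^ n * (3 * (L : ℝ)) ^ (3 * n) * 3 ^ (3 * n) * sβ ^ (3 * n) with hK
  have hK0 : 0 ≤ K := by rw [hK]; positivity
  set a₁ : ℝ := (5 * Real.sqrt 2) ^ (3 * n) with ha₁
  set a₂ : ℝ := Real.sqrt 2 ^ (3 * n) with ha₂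
  -- inner integral in v′
  have hinner : ∀ v : Edge 3 L → Fin 3 → ℝ, ∫ v', Ω (linkEmbed L v) * Ω (linkEmbed L v') *
      (π ^ 2 / 12 * (3 * L * (Real.sqrt (t / β) + 5 * (Real.sqrt 2 * ‖linkEmbed L v‖) + Real.sqrt 2 * ‖linkEmbed L v'‖)) ^ 3) ^ n ∂π' ≤
      Ω (linkEmbed L v) * (K * (((t + 1) ^ (3 * n) + a₁ * (Real.sqrt β * ‖linkEmbed L v‖) ^ (3 * n)) * I₀ + a₂ * Mm)) := by
    intro v
    have hΩv0 : 0 ≤ Ω (linkEmbed L v) := hΩ0 _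
    have hpt : ∀ v', Ω (linkEmbed L v) * Ω (linkEmbed L v') *
        (π ^ 2 / 12 * (3 * L * (Real.sqrt (t / β) + 5 * (Real.sqrt 2 * ‖linkEmbed L v‖) + Real.sqrt 2 * ‖linkEmbed L v'‖)) ^ 3) ^ n ≤
        Ω (linkEmbed L v) * (K * (((t + 1) ^ (3 * n) + a₁ * (Real.sqrt β * ‖linkEmbed L v‖) ^ (3 * n)) * Ω (linkEmbed L v') +
          a₂ * (Ω (linkEmbed L v') * (Real.sqrt β * ‖linkEmbed L v'‖) ^ (3 * n)))) := fun v' => by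
      have h := mul_le_mul_of_nonneg_left (hbox v v') (mul_nonneg hΩv0 (hΩ0 (linkEmbed L v')))
      refine h.trans (le_of_eq ?_)
      rw [hK, ha₁, ha₂]; ring
    have hrhs_i : Integrable (fun v' => Ω (linkEmbed L v) * (K * (((t + 1) ^ (3 * n) + a₁ * (Real.sqrt β * ‖linkEmbed L v‖) ^ (3 * n)) * Ω (linkEmbed L v') +
          a₂ * (Ω (linkEmbed L v') * (Real.sqrt β * ‖linkEmbed L v'‖) ^ (3 * n))))) π' :=
      (((hΩvi.const_mul _).add (hmom_i.const_mul _)).const_mul _).const_mul _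
    by_cases hlhs : Integrable (fun v' => Ω (linkEmbed L v) * Ω (linkEmbed L v') *
        (π ^ 2 / 12 * (3 * L * (Real.sqrt (t / β) + 5 * (Real.sqrt 2 * ‖linkEmbed L v‖) + Real.sqrt 2 * ‖linkEmbed L v'‖)) ^ 3) ^ n) π'
    · refine (integral_mono hlhs hrhs_i hpt).trans (le_of_eq ?_)
      rw [integral_const_mul, integral_const_mul, integral_add (hΩvi.const_mul _) (hmom_i.const_mul _), integral_const_mul, integral_const_mul]
    · rw [integral_undef hlhs]
      exact mul_nonneg hΩv0 (mul_nonneg hK0 (add_nonneg (mul_nonneg (by positivity) hI₀0) (mul_nonneg (by positivity) hMm0)))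
  -- outer integral in v
  have hout_i : Integrable (fun v => Ω (linkEmbed L v) * (K * (((t + 1) ^ (3 * n) + a₁ * (Real.sqrt β * ‖linkEmbed L v‖) ^ (3 * n)) * I₀ + a₂ * Mm))) π' := by
    have e : ∀ v, Ω (linkEmbed L v) * (K * (((t + 1) ^ (3 * n) + a₁ * (Real.sqrt β * ‖linkEmbed L v‖) ^ (3 * n)) * I₀ + a₂ * Mm)) =
        (K * ((t + 1) ^ (3 * n) * I₀ + a₂ * Mm)) * Ω (linkEmbed L v) + (K * a₁ * I₀) * (Ω (linkEmbed L v) * (Real.sqrt β * ‖linkEmbed L v‖) ^ (3 * n)) := fun v => by ring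
    simp_rw [e]
    exact (hΩvi.const_mul _).add (hmom_i.const_mul _)
  have hZ0 : 0 ≤ fpZ ε := by unfold fpZ; exact measureReal_nonneg
  have htot : ∫ v, ∫ v', Ω (linkEmbed L v) * Ω (linkEmbed L v') *
      (π ^ 2 / 12 * (3 * L * (Real.sqrt (t / β) + 5 * (Real.sqrt 2 * ‖linkEmbed L v‖) + Real.sqrt 2 * ‖linkEmbed L v'‖)) ^ 3) ^ n ∂π' ∂π' ≤
      K * (((t + 1) ^ (3 * n) * I₀ + a₂ * Mm) * I₀ + a₁ * I₀ * Mm) := by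
    by_cases hlhs : Integrable (fun v => ∫ v', Ω (linkEmbed L v) * Ω (linkEmbed L v') *
        (π ^ 2 / 12 * (3 * L * (Real.sqrt (t / β) + 5 * (Real.sqrt 2 * ‖linkEmbed L v‖) + Real.sqrt 2 * ‖linkEmbed L v'‖)) ^ 3) ^ n ∂π') π'
    · refine (integral_mono hlhs hout_i hinner).trans (le_of_eq ?_)
      have e : ∀ v, Ω (linkEmbed L v) * (K * (((t + 1) ^ (3 * n) + a₁ * (Real.sqrt β * ‖linkEmbed L v‖) ^ (3 * n)) * I₀ + a₂ * Mm)) =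
          (K * ((t + 1) ^ (3 * n) * I₀ + a₂ * Mm)) * Ω (linkEmbed L v) + (K * a₁ * I₀) * (Ω (linkEmbed L v) * (Real.sqrt β * ‖linkEmbed L v‖) ^ (3 * n)) := fun v => by ring
      simp_rw [e]
      rw [integral_add (hΩvi.const_mul _) (hmom_i.const_mul _), integral_const_mul, integral_const_mul]
      ring
    · rw [integral_undef hlhs]
      exact mul_nonneg hK0 (add_nonneg (mul_nonneg (add_nonneg (mul_nonneg (by positivity) hI₀0) (mul_nonneg (by positivity) hMm0)) hI₀0)
        (mul_nonneg (mul_nonneg (by positivity) hI₀0) hMm0))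
  -- finish: multiply by fpZ and compare with the stated constant (using `(t+1)^{3n} ≥ 1` on the moment terms)
  have ht1 : 1 ≤ (t + 1) ^ (3 * n) := one_le_pow₀ (by linarith)
  calc fpZ ε * ∫ v, ∫ v', Ω (linkEmbed L v) * Ω (linkEmbed L v') *
        (π ^ 2 / 12 * (3 * L * (Real.sqrt (t / β) + 5 * (Real.sqrt 2 * ‖linkEmbed L v‖) + Real.sqrt 2 * ‖linkEmbed L v'‖)) ^ 3) ^ n ∂π' ∂π'
      ≤ fpZ ε * (K * (((t + 1) ^ (3 * n) * I₀ + a₂ * Mm) * I₀ + a₁ * I₀ * Mm)) := mul_le_mul_of_nonneg_left htot hZ0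
    _ ≤ fpZ ε * (K * ((I₀ ^ 2 + (a₁ + a₂) * I₀ * Mm) * (t + 1) ^ (3 * n))) := by
        apply mul_le_mul_of_nonneg_left _ hZ0
        apply mul_le_mul_of_nonneg_left _ hK0
        have h1 : a₂ * Mm * I₀ ≤ a₂ * I₀ * Mm * (t + 1) ^ (3 * n) := by
          have : 0 ≤ a₂ * I₀ * Mm := by positivity
          nlinarith
        have h2 : a₁ * I₀ * Mm ≤ a₁ * I₀ * Mm * (t + 1) ^ (3 * n) := by
          have : 0 ≤ a₁ * I₀ * Mm := by positivity
          nlinarith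
        nlinarith [h1, h2, sq_nonneg I₀]
    _ = (fpZ ε * ((π ^ 2 / 12) ^ n * (3 * (L : ℝ)) ^ (3 * n) * 3 ^ (3 * n) * sβ ^ (3 * n)) * (I₀ ^ 2 + (a₁ + a₂) * I₀ * Mm)) * (t + 1) ^ (3 * n) := by
        rw [hK]; ring

end Summit.QuantumFields.YangMills.Theorems.FemtoTransferGap.RateTube

end
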